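import Mathlib
import HarnessLib
import Summits.HubbardSuperconductivity.HubbardSuperconductivity.Theorems.KLProgrammeKLRegimeEngineV8TwoLegMomentsExportGridC
import Summits.HubbardSuperconductivity.HubbardSuperconductivity.Theorems.KLProgrammeKLRegimeEngineV8TwoLegMomentsExport
import Summits.HubbardSuperconductivity.HubbardSuperconductivity.Theorems.KLProgrammeKLRegimeEngineTwoLegStepV17F2ClosersGridBinderC
import Summits.HubbardSuperconductivity.HubbardSuperconductivity.Theorems.KLProgrammeKLRegimeEngineKernelNormsWt4
import Summits.HubbardSuperconductivity.HubbardSuperconductivity.Theorems.KLProgrammeKLRegimeEngineWtBudget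
import Summits.HubbardSuperconductivity.HubbardSuperconductivity.Theorems.KLProgrammeKLRegimeEngineV8TowerExports2
import Summits.HubbardSuperconductivity.HubbardSuperconductivity.Theorems.KLProgrammeKLRegimeEngineV8DefsG11
import Summits.HubbardSuperconductivity.HubbardSuperconductivity.Theorems.KLProgrammeKLRegimeEngineV8DefsQ9c
import Summits.HubbardSuperconductivity.HubbardSuperconductivity.Theorems.KLProgrammeKLRegimeEngineV8DefsU10
import Summits.HubbardSuperconductivity.HubbardSuperconductivity.Theorems.KLProgrammeKLRegimeEngineV8DefsL4
import Summits.HubbardSuperconductivity.HubbardSuperconductivity.Theorems.KLProgrammeKLRegimeSplitSlotsV17F2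
import Summits.HubbardSuperconductivity.HubbardSuperconductivity.Theorems.KLProgrammeKLRegimeEngineV8TowerCEDefsC
import Summits.HubbardSuperconductivity.HubbardSuperconductivity.Theorems.KLProgrammeKLRegimeEngineV8TowerCoreDefsC

/-!
# K3 ENGINE (stmt-HubbardSuperconductivity-20437 `KLRegimeEngineV17F2`), v2 FREEZE docket tokens #27-literals `klZt / klZs1 / klZs2` and #28 `klEngC₃7` as a
# DEFERRED (`dite/choose`) PACKAGE over the grid-moment producer statement — located OPTION «(b)-GRID-DEFERRED»
# (pen (R174) 2026-08-28: ADOPTED FOR THE FREEZE; text by the 20437 registrant p1b g14, filed by the registrant substitute in the (R174) night window unless the k3c2-p1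
# lineage — owner of the literal module (R60g)(4)/(R60i), first refusal to 23:00Z 08-28 — files it itself; the increments' NUMBERS (GridLiterals part 2) remain the W3/(b) lane's
# T+ producer theorem, k3c2-p3 W3-CURRENCY.md)
# AMENDMENT 23 «(ℓ)-C-SLOT» (pen (R202), CONDITIONAL — GO/NO-GO 23:00Z 08-28): token #28 `klEngC₃7` gains ONE entry `⊓ klTowerCC P R` = the tower's package-chosen
# regime-constant threshold of `…EngineV8TowerCEDefsC` (k3c3-p2 g13; `TowerNormsStepC`/`klTowerPkgC`, `klTowerCC_pos` unconditional) + row `klEngC₃7_le_klTowerCC`; nothing else moves.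
# + registrant joint notes (J3)/(J4): ONE more entry `⊓ klTowerCoreCC9 P R` = the c-threshold of the ATOM-FREE core-C package CAPPED under token #13's `e_T` (`…EngineV8TowerCoreDefsC`,
# whose `towerCoreC9_at_klEngQ9c` closes the CE-joint at `klEngQ9c P R` by name) + row `klEngC₃7_le_klTowerCoreCC9`; zero image tokens.
# + «(b)-C-SLOT-TWIN» (pen (R203)(3) GO): the SAME device on this file's own deferred producer — the c-slotted twin `TwoLegGridMomentsStepCT … cG` (ONE more binder `cc ≤ cG →`;
# `TwoLegGridMomentsStepC.toCT` = nothing a holder of the c-free statement loses), the package gains a c-threshold component (`klGridLitC`, `klGridLitCAt P R`, `_pos`, default 1),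
# the unrolls gain `hcG : cc ≤ klGridLitCAt P R`, and `klEngC₃7 ⊓= klGridLitCAt P R` + row `klEngC₃7_le_klGridLitCAt`; zero image tokens.

WHY.  The rev-13/14 image's §O3 placeholders `klZt_PH / klZs1_PH / klZs2_PH` (+ rows `klZt_PH_base`, `klZs1_PH_nonneg`, `klZs2_PH_base`) and `klEngC₃7_PH`
(+ `_le_klEngC₃6`, `_pos`) are to be replaced at the FREEZE by CLOSED `(P R)`-terms «base + the slice increments' shares» (GridLiterals part 2) and (R60f)'s `klEngC₃7`.
The increments' shares are not typed (no seated owner; the plain-currency decay is a located open question).  But NOTHING downstream reads the literals' VALUES: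
§C reads the three n = 0 rows BY NAME, the (e) closer reads `c ≤ klEngC₃7` and U-rows keyed on the SYMBOLS `klZs1 / klZt / klZs2` (`mixedRow_of_thresholds`,
`klTwoLegMomU`), and the (b) closer must PROVE `TwoLegGridFlowMomentsAtC … (klZt P R) (klZs1 P R) (klZs2 P R) … n`.  So the literals can be the cell's standard
DEFERRED PACKAGE (the device of `klExportPkg2`, `klE4Pkg`, `klIsoMomPkg`, `klSpaceMomPkg5`): chosen by `Classical.choose` from the producer's ∃-statement when it holds,
else the n = 0 base literals — admissible in both branches, so every row the skeleton and the (e) closer read is a theorem TODAY, and the (b) closer obtains its conjunct 5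
from `choose_spec` the day the W3/(b) lane proves the producer statement `∃ e, IsGridLitPkg R e ∧ TwoLegGridMomentsStepCT P R (klEngQ7 P R) klEngGeo11 e.1 e.2.1 e.2.2` (T+;
the c-free `TwoLegGridMomentsStepC` feeds it through `.toCT` with any positive `cG`).
ZERO stub-text change beyond the already-docketed renames (`klZ*_PH ↦ klZ*`, `klEngC₃7_PH ↦ klEngC₃7`; rows = the predicted FREEZE rows); (X) untouched.

* §1 `IsGridLitPkg R e` (bases ≤ literals, `0 ≤ Zs₁`, U-threshold positive, c-threshold positive), `TwoLegGridMomentsStepC P R Q₀ G z u` (J1-shaped producer step: ∀ raise `Q`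
  of `Q₀`, v2 doors + own threshold `u`, `1 ≤ n ≤ n_β+1`, public history, `FrameOK (K_n)`, the (b)-side data at `n` — (E1-v4), levels/Wt4 bundle, class-#1 exports — ⇒ the C-atom
  at `K_n`) and its c-slotted twin **`TwoLegGridMomentsStepCT P R Q₀ G z u cG`** (ONE more binder `cc ≤ cG →`; `.toCT` bridge), the package `klGridLitPkg P R Q₀ G` (deferred over the
  CT statement), projections **`klZt P R`, `klZs1 P R`, `klZs2 P R`** (keyed at `(klEngQ7 P R, klEngGeo11)` = the image's keys), `klGridLitU P R Q₀ G Q cc`, `klGridLitC P R Q₀ G`;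
* §2 the rows the skeleton reads BY NAME: **`klZt_base`, `klZs1_nonneg`, `klZs2_base`**; `klGridLitUAt(_pos)`, `klGridLitCAt(_pos)`; the unroll `twoLegGridFlowMomentsAtC_klZ_of_exists`
  (for the (b) closer; binders `hUu : U ≤ klGridLitUAt …`, `hcG : cc ≤ klGridLitCAt P R`);
* §3 token #28 **`klEngC₃7 P R := min (klEngC₃6 P R) (min (R.cz·ln 4/(1200·(klZs1 P R + 1))) (min (ln 4/(20·(klZs1 P R + 1))) (klTowerCC P R)))`** ((R60f) verbatim on the
  opaque `klZs1` ⊓ AMENDMENT 23's tower c-slots `klTowerCC P R`, `klTowerCoreCC9 P R` ⊓ the twin's `klGridLitCAt P R`), `klEngC₃7_le_klEngC₃6`, `klEngC₃7_le_klTowerCC`,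
  `klEngC₃7_le_klTowerCoreCC9`, `klEngC₃7_le_klGridLitCAt`, `klEngC₃7_pos`; §4 the (e) closer's #28 row from the doors: `klZs1_mixedRow_of_doors`.
Definitions with bodies + order lemmas; nothing about the model is asserted; the producer statement is a HYPOTHESIS slot; nothing asserts any stub of 20437, K3 or superconductivity.
-/

noncomputable section

namespace Summit.HubbardSuperconductivity.HubbardSuperconductivity.Theorems.EngineV8

set_option linter.dupNamespace false -- summit = problem name (single-conjunct summit), D-0017

open Real Finset Literature.MathematicalPhysics.QuantumLattice Literature.Probability.LatticeModels
open Summit.HubbardSuperconductivity.HubbardSuperconductivity.Theorems.KLRegimeSplit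
open Summit.HubbardSuperconductivity.HubbardSuperconductivity.Theorems.KLProgrammeLegKernels
open Summit.HubbardSuperconductivity.HubbardSuperconductivity.Theorems.DispersionFlow

/-! ## §1 The package -/

/-- The n = 0 C-base TIME literal `2¹⁰·e¹⁸·κ₀⁴·klE3A1 R` (`κ₀² = 2(7+1606732)`; = the image's `klZt_PH` dry-run body, `twoLegGridFlowMomentsAtC_zero_klE3A1`'s `Zt`). -/
def klZtBase0 (R : RenConsts) : ℝ := (2 : ℝ) ^ 10 * Real.exp 1 ^ 18 * Real.sqrt (2 * (7 + 1606732)) ^ 4 * klE3A1 R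

/-- The n = 0 C-base SPACE literal `2¹¹·e¹⁸·κ₀⁴·klE3A1 R` (= the image's `klZs2_PH` dry-run body). -/
def klZs2Base0 (R : RenConsts) : ℝ := (2 : ℝ) ^ 11 * Real.exp 1 ^ 18 * Real.sqrt (2 * (7 + 1606732)) ^ 4 * klE3A1 R

/-- **Admissible grid-literal package** `e = ((Zt, Zs₁, Zs₂), u, cG)`: the n = 0 C-base fits (`klZtBase0 R ≤ Zt`, `0 ≤ Zs₁`, `klZs2Base0 R ≤ Zs₂` — the three rows §C reads
at `n = 0`), a U-threshold POSITIVE at every raised package, and («(b)-C-SLOT-TWIN») a POSITIVE regime-constant threshold `cG`. -/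
def IsGridLitPkg (R : RenConsts) (e : (ℝ × ℝ × ℝ) × (EngConsts → ℝ → ℝ) × ℝ) : Prop :=
  klZtBase0 R ≤ e.1.1 ∧ 0 ≤ e.1.2.1 ∧ klZs2Base0 R ≤ e.1.2.2 ∧ (∀ Q cc, 0 < e.2.1 Q cc) ∧ 0 < e.2.2

/-- **The grid-moment PRODUCER STEP** (J1 shape, cf. `LevelsUStep2` / `TwoLegSpaceMomentsStep5`): for every raise `Q` of `Q₀`, under the v2 doors and the step's own
threshold `u`, at every scale `1 ≤ n ≤ n_β + 1`: the public history below `n`, `K_n` admissible, and the (b)-side data AT `n` (kernel norms (E1-v4), the levels/Wt4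
bundle at `j ≤ n`, the class-#1 merged exports at `j ≤ n`) give the C-atom `TwoLegGridFlowMomentsAtC … z.1 z.2.1 z.2.2 cc … n` — VERBATIM stub (b)'s fifth conjunct at the literals `z`. -/
def TwoLegGridMomentsStepC (P : SplitConsts) (R : RenConsts) (Q₀ : EngConsts) (G : GeoConsts) (z : ℝ × ℝ × ℝ) (u : EngConsts → ℝ → ℝ) : Prop :=
  ∀ Q : EngConsts, Q₀.IsRaiseOf Q →
    ∀ cc : ℝ, 0 < cc → cc ≤ klEngC₃6 P R →
      ∀ μ ∈ klWindowC, ∀ U : ℝ, 0 < U → U ≤ klEngU₀10 P R cc → U ≤ u Q cc →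
        ∀ β : ℝ, klBetaMin ≤ β → β ≤ Real.exp (cc / U ^ 2) →
          ∀ (L M : ℕ) [NeZero L] [NeZero M], klEngL₄ P R β U ≤ L → klEngM₃ β U L ≤ M →
            ∀ n : ℕ, 1 ≤ n → n ≤ nScales β + 1 →
              HistP klPredsV17F2 L M G P Q R β U μ 0 n →
                FrameOK R U (nScales β) μ (klFlowFrameU L M β U μ n) →
                  KernelNormsV4 L M P Q β U μ (klFlowFrameU L M β U μ n) n →
                    (∀ j ≤ n, (KernelNormsLevels L M P Q β U μ (klFlowFrameU L M β U μ n) j ∧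
                      KernelNormsWt4 L M (klWtBudget P Q U j) β U μ (klFlowFrameU L M β U μ n) j)) →
                      (∀ j ≤ n, LevelsUExportMixedAt L M (klCU2 P R Q₀) P β U μ j) →
                        TwoLegGridFlowMomentsAtC L M z.1 z.2.1 z.2.2 cc β U μ n

/-- **`TwoLegGridMomentsStepCT P R Q₀ G z u cG`** («(b)-C-SLOT-TWIN», pen (R203)(3)) — `TwoLegGridMomentsStepC P R Q₀ G z u` with ONE more binder: the regime constant is
also below the producer's OWN threshold, `cc ≤ cG` (inserted right after `cc ≤ klEngC₃6 P R`); everything else VERBATIM.  The package below defers over THIS statement, so the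
T+ producer may choose `cG` exactly as it chooses `u`. -/
def TwoLegGridMomentsStepCT (P : SplitConsts) (R : RenConsts) (Q₀ : EngConsts) (G : GeoConsts) (z : ℝ × ℝ × ℝ) (u : EngConsts → ℝ → ℝ) (cG : ℝ) : Prop :=
  ∀ Q : EngConsts, Q₀.IsRaiseOf Q →
    ∀ cc : ℝ, 0 < cc → cc ≤ klEngC₃6 P R → cc ≤ cG →
      ∀ μ ∈ klWindowC, ∀ U : ℝ, 0 < U → U ≤ klEngU₀10 P R cc → U ≤ u Q cc →
        ∀ β : ℝ, klBetaMin ≤ β → β ≤ Real.exp (cc / U ^ 2) →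
          ∀ (L M : ℕ) [NeZero L] [NeZero M], klEngL₄ P R β U ≤ L → klEngM₃ β U L ≤ M →
            ∀ n : ℕ, 1 ≤ n → n ≤ nScales β + 1 →
              HistP klPredsV17F2 L M G P Q R β U μ 0 n →
                FrameOK R U (nScales β) μ (klFlowFrameU L M β U μ n) →
                  KernelNormsV4 L M P Q β U μ (klFlowFrameU L M β U μ n) n →
                    (∀ j ≤ n, (KernelNormsLevels L M P Q β U μ (klFlowFrameU L M β U μ n) j ∧
                      KernelNormsWt4 L M (klWtBudget P Q U j) β U μ (klFlowFrameU L M β U μ n) j)) →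
                      (∀ j ≤ n, LevelsUExportMixedAt L M (klCU2 P R Q₀) P β U μ j) →
                        TwoLegGridFlowMomentsAtC L M z.1 z.2.1 z.2.2 cc β U μ n

/-- **The c-free producer statement implies the c-slotted one for every threshold** (the extra binder is simply not used: nothing a holder of `TwoLegGridMomentsStepC` loses). -/
theorem TwoLegGridMomentsStepC.toCT {P : SplitConsts} {R : RenConsts} {Q₀ : EngConsts} {G : GeoConsts} {z : ℝ × ℝ × ℝ} {u : EngConsts → ℝ → ℝ}
    (h : TwoLegGridMomentsStepC P R Q₀ G z u) (cG : ℝ) : TwoLegGridMomentsStepCT P R Q₀ G z u cG :=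
  fun Q hQ cc hc hc36 _ => h Q hQ cc hc hc36

/-- The n = 0 base package `((klZtBase0 R, 0, klZs2Base0 R), 1, 1)` is admissible. -/
theorem isGridLitPkg_base (R : RenConsts) : IsGridLitPkg R ((klZtBase0 R, 0, klZs2Base0 R), fun _ _ => 1, 1) :=
  ⟨le_rfl, le_rfl, le_rfl, fun _ _ => one_pos, one_pos⟩

variable (P : SplitConsts) (R : RenConsts) (Q₀ : EngConsts) (G : GeoConsts)

open Classical in
/-- **The deferred grid-literal package**: the producer's package when `∃ e, IsGridLitPkg R e ∧ TwoLegGridMomentsStepCT P R Q₀ G e.1 e.2.1 e.2.2` (the c-slotted producer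
statement), else the n = 0 base package `((bases), 1, 1)`. -/
def klGridLitPkg : (ℝ × ℝ × ℝ) × (EngConsts → ℝ → ℝ) × ℝ :=
  if h : ∃ e : (ℝ × ℝ × ℝ) × (EngConsts → ℝ → ℝ) × ℝ, IsGridLitPkg R e ∧ TwoLegGridMomentsStepCT P R Q₀ G e.1 e.2.1 e.2.2 then Classical.choose h
  else ((klZtBase0 R, 0, klZs2Base0 R), fun _ _ => 1, 1)

/-- The deferred package is admissible (both branches). -/
theorem isGridLitPkg_klGridLitPkg : IsGridLitPkg R (klGridLitPkg P R Q₀ G) := by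
  classical
  unfold klGridLitPkg
  split_ifs with h
  · exact (Classical.choose_spec h).1
  · exact isGridLitPkg_base R

/-- The producer's U-threshold of the deferred package. -/
def klGridLitU (Q : EngConsts) (cc : ℝ) : ℝ := (klGridLitPkg P R Q₀ G).2.1 Q cc

/-- `0 < klGridLitU …` (unconditional). -/
theorem klGridLitU_pos (Q : EngConsts) (cc : ℝ) : 0 < klGridLitU P R Q₀ G Q cc := (isGridLitPkg_klGridLitPkg P R Q₀ G).2.2.2.1 Q cc

/-- The producer's regime-constant threshold of the deferred package («(b)-C-SLOT-TWIN»). -/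
def klGridLitC : ℝ := (klGridLitPkg P R Q₀ G).2.2

/-- `0 < klGridLitC …` (unconditional). -/
theorem klGridLitC_pos : 0 < klGridLitC P R Q₀ G := (isGridLitPkg_klGridLitPkg P R Q₀ G).2.2.2.2

variable {Q₀ G}

/-- **UNROLL**: from the producer's ∃-statement the C-atom at the package's literals, under the step's binders (for the (b) closer's fifth conjunct). -/
theorem twoLegGridFlowMomentsAtC_pkg_of_exists {Q : EngConsts} {cc μ U β : ℝ} {L M : ℕ} [NeZero L] [NeZero M] {n : ℕ}
    (hex : ∃ e : (ℝ × ℝ × ℝ) × (EngConsts → ℝ → ℝ) × ℝ, IsGridLitPkg R e ∧ TwoLegGridMomentsStepCT P R Q₀ G e.1 e.2.1 e.2.2) (hQ : Q₀.IsRaiseOf Q)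
    (hc : 0 < cc) (hc36 : cc ≤ klEngC₃6 P R) (hcG : cc ≤ klGridLitC P R Q₀ G) (hμ : μ ∈ klWindowC) (hU : 0 < U) (hU10 : U ≤ klEngU₀10 P R cc)
    (hUu : U ≤ klGridLitU P R Q₀ G Q cc)
    (hβ : klBetaMin ≤ β) (hβc : β ≤ Real.exp (cc / U ^ 2)) (hL : klEngL₄ P R β U ≤ L) (hM : klEngM₃ β U L ≤ M) (hn1 : 1 ≤ n) (hn : n ≤ nScales β + 1)
    (hhist : HistP klPredsV17F2 L M G P Q R β U μ 0 n) (hfr : FrameOK R U (nScales β) μ (klFlowFrameU L M β U μ n))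
    (hN : KernelNormsV4 L M P Q β U μ (klFlowFrameU L M β U μ n) n)
    (hlev : ∀ j ≤ n, (KernelNormsLevels L M P Q β U μ (klFlowFrameU L M β U μ n) j ∧ KernelNormsWt4 L M (klWtBudget P Q U j) β U μ (klFlowFrameU L M β U μ n) j))
    (hlevU : ∀ j ≤ n, LevelsUExportMixedAt L M (klCU2 P R Q₀) P β U μ j) :
    TwoLegGridFlowMomentsAtC L M (klGridLitPkg P R Q₀ G).1.1 (klGridLitPkg P R Q₀ G).1.2.1 (klGridLitPkg P R Q₀ G).1.2.2 cc β U μ n := by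
  have hstep : TwoLegGridMomentsStepCT P R Q₀ G (klGridLitPkg P R Q₀ G).1 (klGridLitPkg P R Q₀ G).2.1 (klGridLitPkg P R Q₀ G).2.2 := by
    have e : klGridLitPkg P R Q₀ G = Classical.choose hex := by classical unfold klGridLitPkg; rw [dif_pos hex]
    rw [e]; exact (Classical.choose_spec hex).2
  exact hstep Q hQ cc hc hc36 hcG μ hμ U hU hU10 hUu β hβ hβc L M hL hM n hn1 hn hhist hfr hN hlev hlevU

/-! ## §2 The docket literals (token #27 family) at the image's keys `(klEngQ7 P R, klEngGeo11)` and the rows §C reads BY NAME -/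

variable (P : SplitConsts) (R : RenConsts)

/-- **`klZt P R`** — the (T′-B) TIME-row literal (deferred; `= klZtBase0 R` unless the producer statement holds). -/
def klZt : ℝ := (klGridLitPkg P R (klEngQ7 P R) klEngGeo11).1.1

/-- **`klZs1 P R`** — the (T′-B) mixed SPACE-row `ĉ·|U|` literal (deferred; `= 0` unless the producer statement holds). -/
def klZs1 : ℝ := (klGridLitPkg P R (klEngQ7 P R) klEngGeo11).1.2.1

/-- **`klZs2 P R`** — the (T′-B) SPACE-row `U²` literal (deferred; `= klZs2Base0 R` unless the producer statement holds). -/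
def klZs2 : ℝ := (klGridLitPkg P R (klEngQ7 P R) klEngGeo11).1.2.2

/-- **§C n = 0 row**: `2¹⁰·e¹⁸·κ₀⁴·klE3A1 R ≤ klZt P R` (the FREEZE rename target of `klZt_PH_base`). -/
theorem klZt_base : (2 : ℝ) ^ 10 * Real.exp 1 ^ 18 * Real.sqrt (2 * (7 + 1606732)) ^ 4 * klE3A1 R ≤ klZt P R :=
  (isGridLitPkg_klGridLitPkg P R (klEngQ7 P R) klEngGeo11).1

/-- **§C n = 0 row**: `0 ≤ klZs1 P R` (target of `klZs1_PH_nonneg`). -/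
theorem klZs1_nonneg : 0 ≤ klZs1 P R := (isGridLitPkg_klGridLitPkg P R (klEngQ7 P R) klEngGeo11).2.1

/-- **§C n = 0 row**: `2¹¹·e¹⁸·κ₀⁴·klE3A1 R ≤ klZs2 P R` (target of `klZs2_PH_base`). -/
theorem klZs2_base : (2 : ℝ) ^ 11 * Real.exp 1 ^ 18 * Real.sqrt (2 * (7 + 1606732)) ^ 4 * klE3A1 R ≤ klZs2 P R :=
  (isGridLitPkg_klGridLitPkg P R (klEngQ7 P R) klEngGeo11).2.2.1

/-- **The producer's U-threshold at the image's keys** (a U12b entry): `klGridLitUAt P R Q cc := klGridLitU P R (klEngQ7 P R) klEngGeo11 Q cc`. -/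
def klGridLitUAt (Q : EngConsts) (cc : ℝ) : ℝ := klGridLitU P R (klEngQ7 P R) klEngGeo11 Q cc

/-- `0 < klGridLitUAt P R Q cc`. -/
theorem klGridLitUAt_pos (Q : EngConsts) (cc : ℝ) : 0 < klGridLitUAt P R Q cc := klGridLitU_pos P R _ _ Q cc

/-- **The producer's c-threshold at the image's keys** (a c-chain entry of `klEngC₃7`, «(b)-C-SLOT-TWIN»): `klGridLitCAt P R := klGridLitC P R (klEngQ7 P R) klEngGeo11`. -/
def klGridLitCAt : ℝ := klGridLitC P R (klEngQ7 P R) klEngGeo11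

/-- `0 < klGridLitCAt P R`. -/
theorem klGridLitCAt_pos : 0 < klGridLitCAt P R := klGridLitC_pos P R _ _

variable {P R}

/-- **UNROLL AT THE IMAGE'S KEYS** — the (b) closer's fifth conjunct at the docket literals from the producer's ∃-statement. -/
theorem twoLegGridFlowMomentsAtC_klZ_of_exists {Q : EngConsts} {cc μ U β : ℝ} {L M : ℕ} [NeZero L] [NeZero M] {n : ℕ}
    (hex : ∃ e : (ℝ × ℝ × ℝ) × (EngConsts → ℝ → ℝ) × ℝ, IsGridLitPkg R e ∧ TwoLegGridMomentsStepCT P R (klEngQ7 P R) klEngGeo11 e.1 e.2.1 e.2.2)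
    (hQ : (klEngQ7 P R).IsRaiseOf Q) (hc : 0 < cc) (hc36 : cc ≤ klEngC₃6 P R) (hcG : cc ≤ klGridLitCAt P R) (hμ : μ ∈ klWindowC) (hU : 0 < U)
    (hU10 : U ≤ klEngU₀10 P R cc)
    (hUu : U ≤ klGridLitUAt P R Q cc) (hβ : klBetaMin ≤ β) (hβc : β ≤ Real.exp (cc / U ^ 2)) (hL : klEngL₄ P R β U ≤ L) (hM : klEngM₃ β U L ≤ M)
    (hn1 : 1 ≤ n) (hn : n ≤ nScales β + 1) (hhist : HistP klPredsV17F2 L M klEngGeo11 P Q R β U μ 0 n) (hfr : FrameOK R U (nScales β) μ (klFlowFrameU L M β U μ n))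
    (hN : KernelNormsV4 L M P Q β U μ (klFlowFrameU L M β U μ n) n)
    (hlev : ∀ j ≤ n, (KernelNormsLevels L M P Q β U μ (klFlowFrameU L M β U μ n) j ∧ KernelNormsWt4 L M (klWtBudget P Q U j) β U μ (klFlowFrameU L M β U μ n) j))
    (hlevU : ∀ j ≤ n, LevelsUExportMixedAt L M (klCU2 P R (klEngQ7 P R)) P β U μ j) :
    TwoLegGridFlowMomentsAtC L M (klZt P R) (klZs1 P R) (klZs2 P R) cc β U μ n :=
  twoLegGridFlowMomentsAtC_pkg_of_exists P R hex hQ hc hc36 hcG hμ hU hU10 hUu hβ hβc hL hM hn1 hn hhist hfr hN hlev hlevU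

/-! ## §3 Token #28 `klEngC₃7` ((R60f) verbatim on the opaque `klZs1`, ⊓ AMENDMENT 23's tower c-slots `klTowerCC P R` (full deliverable), `klTowerCoreCC9 P R` (capped core-C) ⊓ the twin's `klGridLitCAt P R`) -/

variable (P R)

/-- **`klEngC₃7 P R := min klEngC₃6 (min (R.cz·ln 4/(1200·(klZs1+1))) (min (ln 4/(20·(klZs1+1))) (min klTowerCC (min klTowerCoreCC9 klGridLitCAt))))`** — token #28 of the
v2 FREEZE docket: (R60f)'s two `klZs1` rows; (AMENDMENT 23 «(ℓ)-C-SLOT», pen (R202)/(R203)) the tower's package-chosen regime-constant thresholds `klTowerCC P R` (the full c-slotted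
deliverable's, `…EngineV8TowerCEDefsC`) and `klTowerCoreCC9 P R` (the atom-free core-C package capped under token #13's `e_T`, `…EngineV8TowerCoreDefsC`); («(b)-C-SLOT-TWIN»,
pen (R203)(3)) this file's own producer's threshold `klGridLitCAt P R` — each at the END of the min-chain. -/
def klEngC₃7 : ℝ :=
  min (klEngC₃6 P R) (min (R.cz * Real.log 4 / (1200 * (klZs1 P R + 1))) (min (Real.log 4 / (20 * (klZs1 P R + 1)))
    (min (klTowerCC P R) (min (klTowerCoreCC9 P R) (klGridLitCAt P R)))))

/-- THE #28 LIFT LINE `klEngC₃7 ≤ klEngC₃6` (target of `klEngC₃7_PH_le_klEngC₃6`). -/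
theorem klEngC₃7_le_klEngC₃6 : klEngC₃7 P R ≤ klEngC₃6 P R := min_le_left _ _

/-- `klEngC₃7 ≤ R.cz·ln 4/(1200·(klZs1 P R + 1))`. -/
theorem klEngC₃7_le_cz_row : klEngC₃7 P R ≤ R.cz * Real.log 4 / (1200 * (klZs1 P R + 1)) := (min_le_right _ _).trans (min_le_left _ _)

/-- `klEngC₃7 ≤ ln 4/(20·(klZs1 P R + 1))`. -/
theorem klEngC₃7_le_log_row : klEngC₃7 P R ≤ Real.log 4 / (20 * (klZs1 P R + 1)) := (min_le_right _ _).trans ((min_le_right _ _).trans (min_le_left _ _))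

/-- **AMENDMENT 23 row**: `klEngC₃7 ≤ klTowerCC P R` — the stub-(b) closer reads the tower's c-slot binder `cc ≤ klTowerCC P R` of `TowerNormsStepC` as `hc3.trans (klEngC₃7_le_klTowerCC P R)`. -/
theorem klEngC₃7_le_klTowerCC : klEngC₃7 P R ≤ klTowerCC P R := (min_le_right _ _).trans ((min_le_right _ _).trans ((min_le_right _ _).trans (min_le_left _ _)))

/-- **AMENDMENT 23 row (registrant (J3)/(J4))**: `klEngC₃7 ≤ klTowerCoreCC9 P R` — the capped core-C package's c-threshold; the stub-(b) closer feeds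
`towerCoreC9_at_klEngQ9c`'s `hccT` as `hc3.trans (klEngC₃7_le_klTowerCoreCC9 P R)`. -/
theorem klEngC₃7_le_klTowerCoreCC9 : klEngC₃7 P R ≤ klTowerCoreCC9 P R :=
  (min_le_right _ _).trans ((min_le_right _ _).trans ((min_le_right _ _).trans ((min_le_right _ _).trans (min_le_left _ _))))

/-- **«(b)-C-SLOT-TWIN» row**: `klEngC₃7 ≤ klGridLitCAt P R` — the (b) closer feeds `twoLegGridFlowMomentsAtC_klZ_of_exists`'s `hcG` as `hc3.trans (klEngC₃7_le_klGridLitCAt P R)`. -/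
theorem klEngC₃7_le_klGridLitCAt : klEngC₃7 P R ≤ klGridLitCAt P R :=
  (min_le_right _ _).trans ((min_le_right _ _).trans ((min_le_right _ _).trans ((min_le_right _ _).trans (min_le_right _ _))))

variable {R}

/-- `0 < klEngC₃7 P R` under `R.WF2` (`0 < R.cz`; `0 ≤ klZs1`; `0 < klTowerCC`, `0 < klTowerCoreCC9`, `0 < klGridLitCAt` unconditionally). The image's witness line reads `klEngC₃7_pos P hR`. -/
theorem klEngC₃7_pos (hR : R.WF2) : 0 < klEngC₃7 P R := by
  have hcz : 0 < R.cz := hR.2.2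
  have hZ : 0 < klZs1 P R + 1 := by linarith [klZs1_nonneg P R]
  have hlog : 0 < Real.log 4 := Real.log_pos (by norm_num)
  exact lt_min (klEngC₃6_pos P R) (lt_min (by positivity) (lt_min (by positivity) (lt_min (klTowerCC_pos P R) (lt_min (klTowerCoreCC9_pos P R) (klGridLitCAt_pos P R)))))

/-! ## §4 The (e) closer's #28 row from the doors -/

/-- **THE #28 ROW FROM THE DOORS**: `c ≤ klEngC₃7 P R`, `0 < U ≤ 1`, `U ≤ R.cz/(1200·(klZs1+1))`, `U ≤ 1/(20·(klZs1+1))` ⇒ `klZs1·(c/ln 4 + U²) ≤ min (cz/600) (1/10)`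
(`mixedRow_of_thresholds` on the opaque literal; the two U-rows are U12b entries). -/
theorem klZs1_mixedRow_of_doors {c U : ℝ} (hc : c ≤ klEngC₃7 P R) (hU : 0 < U) (hU1 : U ≤ 1)
    (hU2 : U ≤ R.cz / (1200 * (klZs1 P R + 1))) (hU3 : U ≤ 1 / (20 * (klZs1 P R + 1))) :
    klZs1 P R * (c / Real.log 4 + U ^ 2) ≤ min (R.cz / 600) (1 / 10) :=
  mixedRow_of_thresholds (klZs1_nonneg P R) hU hU1 (hc.trans (klEngC₃7_le_cz_row P R)) (hc.trans (klEngC₃7_le_log_row P R)) hU2 hU3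

end Summit.HubbardSuperconductivity.HubbardSuperconductivity.Theorems.EngineV8

end
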